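import Summits.MatrixMultiplication.MatrixMultiplication.Theorems.SoloInformedTwistedMatchingsPGroup
import HarnessLib

/-!
# Group association schemes (Cohn–Umans 2013 §6.3) force large hosts

Solo-informed seat (MatrixMultiplication), gen 102; sharpest-statement §2y(8), D13 for NON-ABELIAN hosts.
Cohn–Umans 2013 §6.3: the Schurian scheme of `G × G` acting on `G` by `x g y⁻¹` is a commutative
association scheme for every finite group `G` ("attractive for our application"), with classes the
conjugacy classes (`R_i = {(g,h) : g h⁻¹ ∈ C_i}`); classes `i, j, k` support a triangle iff
`∃ g ∈ C_i, h ∈ C_j, l ∈ C_k` with `g h l = 1`. In the language of this series it is the translation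
scheme `𝒮(G, Inn G)`, and "triangle" is the twisted triangle predicate `a · φ(b) · ψ(d) = 1`,
`(φ, ψ) ∈ (Inn G)²` (`triangle_iff_twisted_group`). Consequently every bound
"twisted matchings in `S` have `|ι| ≤ 3|S|^r`" turns a realization of `⟨3N,3N,3N⟩` (CU13 Def. 11/12)
in `𝒮(S, M₀)` — ANY `M₀ ≤ Aut S`, in particular the group association scheme and all its fusions by
automorphisms — into `N² e^{-4√(log N)} ≤ 3 |S|^r`:

* `realization_card_ge_behrend_of_rpow_group`, `translationScheme_card_ge_behrend_group`,
  `groupScheme_card_ge_behrend` (arbitrary finite `S`, hypothesis = the twisted-matching bound);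
* `groupScheme_exp_three_class_two` — exponent `3`, class `≤ 2`: `N² e^{-4√(log N)} ≤ 3 |S|^{24/25}`;
* `translationScheme_pGroup_card_ge_behrend` — `p`-groups of class `≤ c`, exponent `∣ p^e`:
  `N² e^{-4√(log N)} ≤ 3 |S|^{1-δ(p,c,e)}`.

D13 placement: `|Inn G| = |G/Z(G)|` is itself a multiplier of polynomial size, so for non-abelian hosts
this is regime (a) of the open list (`|G| ≥ n^{2/r - o(1)}`, no rank lower bound `k(G) ≥ n^{2+δ}`).
References: CohnUmans2013 (arXiv:1207.6528) §6.3, Def. 11/12; BlasiakChurchCohnGrochowUmans2017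
(arXiv:1712.02302) Cor. 3.20; Behrend 1946.
-/

noncomputable section

open scoped BigOperators
open Finset Literature.Combinatorics.Additive Literature.Barriers.MatrixMultiplication

namespace Summit.MatrixMultiplication.MatrixMultiplication.Theorems.TwistedSliceRank

section GroupSchemes

/-- **Triangles of a translation scheme over an arbitrary finite group = the twisted triangle
predicate** (the tree's `triangle_iff_twisted` without commutativity): if `c : S → C` labels the
orbits of `M₀ ≤ Aut S` and `c a = i, c b = j, c d = k`, then
`(∃ g h l, c g = i ∧ c h = j ∧ c l = k ∧ g h l = 1) ⟺ ∃ (φ, ψ) ∈ M₀², a · φ(b) · ψ(d) = 1`.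
[CU13 Def. 11, unfolded] -/
theorem triangle_iff_twisted_group {S : Type*} [Group S] (M₀ : Subgroup (MulAut S)) {C : Type*}
    (c : S → C) (hc : ∀ g h : S, c g = c h ↔ ∃ φ : M₀, (φ : MulAut S) g = h)
    {a b d : S} {i j k : C} (ha : c a = i) (hb : c b = j) (hd : c d = k) :
    (∃ g h l : S, c g = i ∧ c h = j ∧ c l = k ∧ g * h * l = 1) ↔
      ∃ s : M₀ × M₀, a * (s.1 : MulAut S) b * (s.2 : MulAut S) d = 1 := by
  constructor
  · rintro ⟨g, h, l, hg, hh, hl, hghl⟩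
    obtain ⟨φ₁, h1⟩ := (hc g a).1 (hg.trans ha.symm)
    obtain ⟨φ₂, h2⟩ := (hc h b).1 (hh.trans hb.symm)
    obtain ⟨φ₃, h3⟩ := (hc l d).1 (hl.trans hd.symm)
    refine ⟨(φ₁ * φ₂⁻¹, φ₁ * φ₃⁻¹), ?_⟩
    have h2' : ((φ₂ : MulAut S)⁻¹) b = h := by
      rw [MulAut.inv_def, MulEquiv.symm_apply_eq]; exact h2.symm
    have h3' : ((φ₃ : MulAut S)⁻¹) d = l := by
      rw [MulAut.inv_def, MulEquiv.symm_apply_eq]; exact h3.symm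
    simp only [Subgroup.coe_mul, Subgroup.coe_inv, MulAut.mul_apply, h2', h3', ← h1, ← map_mul, hghl,
      map_one]
  · rintro ⟨s, hs⟩
    refine ⟨a, (s.1 : MulAut S) b, (s.2 : MulAut S) d, ha, ?_, ?_, hs⟩
    · rw [← hb]; exact ((hc b _).2 ⟨s.1, rfl⟩).symm
    · rw [← hd]; exact ((hc d _).2 ⟨s.2, rfl⟩).symm

/-- **Realizations of `⟨3N,3N,3N⟩` by the twisted triangle predicate force large hosts** (arbitrary
finite group `S`): if every twisted matching in `S` has `|ι| ≤ 3 |S|^r`, then a realization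
`α, β, γ : [3N]² → S` of `⟨3N,3N,3N⟩` for the predicate `∃ s, α x · φ_s(β y) · ψ_s(γ z) = 1` forces
`N² e^{-4√(log N)} ≤ 3 |S|^r` (Behrend + induced matchings of the matrix-multiplication tensor).
[this work] -/
theorem realization_card_ge_behrend_of_rpow_group (S : Type) [Group S] [Fintype S] [DecidableEq S]
    (r : ℝ)
    (hbound : ∀ (σ : Type) [Fintype σ] (φ ψ : σ → S ≃* S) (ι : Type) [Fintype ι]
      (x y z : ι → S),
      (∀ i j l : ι, (∃ s : σ, x i * φ s (y j) * ψ s (z l) = 1) ↔ (i = j ∧ j = l)) →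
      (Fintype.card ι : ℝ) ≤ 3 * (Fintype.card S : ℝ) ^ r)
    (σ : Type) [Fintype σ] (φ ψ : σ → S ≃* S) (N : ℕ)
    (α β γ : Fin (3 * N) × Fin (3 * N) → S)
    (hreal : ∀ x y z : Fin (3 * N) × Fin (3 * N),
      (∃ s : σ, α x * φ s (β y) * ψ s (γ z) = 1) ↔ (y.1 = x.2 ∧ z = (y.2, x.1))) :
    ((N : ℝ) ^ 2 * Real.exp (-4 * Real.sqrt (Real.log N))) ≤
      3 * (Fintype.card S : ℝ) ^ r := by
  obtain ⟨t, htN, htcard, ht⟩ := rothNumberNat_spec N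
  obtain ⟨a, b, c', -, hind⟩ := threeAPFree_inducedMatching ht htN
  have hmatch : ∀ i j l : ↥t × Fin N,
      (∃ s : σ, α (a i, b i) * φ s (β (b j, c' j)) * ψ s (γ (c' l, a l)) = 1) ↔
        (i = j ∧ j = l) := by
    intro i j l
    rw [hreal (a i, b i) (b j, c' j) (c' l, a l)]
    constructor
    · rintro ⟨h1, h2⟩
      simp only [Prod.mk.injEq] at h2
      exact hind i j l h1 h2.1 h2.2
    · rintro ⟨rfl, rfl⟩
      exact ⟨rfl, rfl⟩
  have h := hbound σ φ ψ (↥t × Fin N)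
    (fun i => α (a i, b i)) (fun j => β (b j, c' j)) (fun l => γ (c' l, a l)) hmatch
  have hcard : Fintype.card (↥t × Fin N) = rothNumberNat N * N := by
    rw [Fintype.card_prod, Fintype.card_coe, htcard, Fintype.card_fin]
  rw [hcard] at h
  push_cast at h
  have hB : (N : ℝ) * Real.exp (-4 * Real.sqrt (Real.log N)) ≤ rothNumberNat N :=
    Behrend.roth_lower_bound
  have hN : (0 : ℝ) ≤ N := Nat.cast_nonneg N
  calc (N : ℝ) ^ 2 * Real.exp (-4 * Real.sqrt (Real.log N))
      = ((N : ℝ) * Real.exp (-4 * Real.sqrt (Real.log N))) * N := by ring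
    _ ≤ (rothNumberNat N : ℝ) * N := mul_le_mul_of_nonneg_right hB hN
    _ ≤ _ := h

/-- **Translation schemes over an arbitrary finite group force large hosts.** If every twisted
matching in `S` has `|ι| ≤ 3 |S|^r`, then a realization of `⟨3N,3N,3N⟩` in the translation scheme
`𝒮(S, M₀)` (Cohn–Umans 2013 Def. 11/12; `c : S → C` an `M₀`-orbit labelling, `M₀ ≤ Aut S`
arbitrary; "classes `i, j, k` form a triangle" `⟺ ∃ g h l` with labels `i, j, k` and `g h l = 1`)
forces `N² e^{-4√(log N)} ≤ 3 |S|^r` (and `|S| ≤ |C|·|M₀|`, `card_le_card_labels_mul`). [this work] -/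
theorem translationScheme_card_ge_behrend_group (S : Type) [Group S] [Fintype S]
    [DecidableEq S] (r : ℝ)
    (hbound : ∀ (σ : Type) [Fintype σ] (φ ψ : σ → S ≃* S) (ι : Type) [Fintype ι]
      (x y z : ι → S),
      (∀ i j l : ι, (∃ s : σ, x i * φ s (y j) * ψ s (z l) = 1) ↔ (i = j ∧ j = l)) →
      (Fintype.card ι : ℝ) ≤ 3 * (Fintype.card S : ℝ) ^ r)
    (M₀ : Subgroup (MulAut S)) [Fintype M₀] (C : Type) (c : S → C)
    (hc : ∀ g h : S, c g = c h ↔ ∃ φ : M₀, (φ : MulAut S) g = h) (N : ℕ)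
    (A B Γ : Fin (3 * N) × Fin (3 * N) → C)
    (hreal : ∀ x y z : Fin (3 * N) × Fin (3 * N),
      (∃ g h l : S, c g = A x ∧ c h = B y ∧ c l = Γ z ∧ g * h * l = 1) ↔
        (y.1 = x.2 ∧ z = (y.2, x.1))) :
    ((N : ℝ) ^ 2 * Real.exp (-4 * Real.sqrt (Real.log N))) ≤
      3 * (Fintype.card S : ℝ) ^ r := by
  rcases Nat.eq_zero_or_pos N with hN | hN
  · subst hN
    simp only [Nat.cast_zero, ne_eq, OfNat.ofNat_ne_zero, not_false_eq_true, zero_pow, zero_mul]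
    positivity
  have w : Fin (3 * N) := ⟨0, by omega⟩
  have hA : ∀ x, ∃ g : S, c g = A x := fun x => by
    obtain ⟨g, h, l, hg, -, -, -⟩ := (hreal x (x.2, w) (w, x.1)).2 ⟨rfl, rfl⟩
    exact ⟨g, hg⟩
  have hB : ∀ y, ∃ g : S, c g = B y := fun y => by
    obtain ⟨g, h, l, -, hh, -, -⟩ := (hreal (w, y.1) y (y.2, w)).2 ⟨rfl, rfl⟩
    exact ⟨h, hh⟩
  have hΓ : ∀ z, ∃ g : S, c g = Γ z := fun z => by
    obtain ⟨g, h, l, -, -, hl, -⟩ := (hreal (z.2, w) (w, z.1) z).2 ⟨rfl, Prod.ext rfl rfl⟩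
    exact ⟨l, hl⟩
  choose α hα using hA
  choose β hβ using hB
  choose γ hγ using hΓ
  refine realization_card_ge_behrend_of_rpow_group S r hbound (↥M₀ × ↥M₀)
    (fun s => (s.1 : MulAut S)) (fun s => (s.2 : MulAut S)) N α β γ (fun x y z => ?_)
  rw [← hreal x y z]
  exact (triangle_iff_twisted_group M₀ c hc (hα x) (hβ y) (hγ z)).symm

/-- **Group association schemes (Cohn–Umans 2013 §6.3) force large hosts.** In the group association
scheme of a finite group `S` (classes `R_i = {(g,h) : g h⁻¹ ∈ C_i}`, `C_i` the conjugacy classes;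
`c : S → C` any labelling with `c g = c h ⟺ g, h conjugate`), the classes `i, j, k` support a
triangle iff `∃ g ∈ C_i, h ∈ C_j, l ∈ C_k` with `g h l = 1`; if every twisted matching in `S` has
`|ι| ≤ 3 |S|^r`, a realization of `⟨3N,3N,3N⟩` forces `N² e^{-4√(log N)} ≤ 3 |S|^r`. [this work] -/
theorem groupScheme_card_ge_behrend (S : Type) [Group S] [Fintype S] [DecidableEq S] (r : ℝ)
    (hbound : ∀ (σ : Type) [Fintype σ] (φ ψ : σ → S ≃* S) (ι : Type) [Fintype ι]
      (x y z : ι → S),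
      (∀ i j l : ι, (∃ s : σ, x i * φ s (y j) * ψ s (z l) = 1) ↔ (i = j ∧ j = l)) →
      (Fintype.card ι : ℝ) ≤ 3 * (Fintype.card S : ℝ) ^ r)
    (C : Type) (c : S → C) (hc : ∀ g h : S, c g = c h ↔ IsConj g h) (N : ℕ)
    (A B Γ : Fin (3 * N) × Fin (3 * N) → C)
    (hreal : ∀ x y z : Fin (3 * N) × Fin (3 * N),
      (∃ g h l : S, c g = A x ∧ c h = B y ∧ c l = Γ z ∧ g * h * l = 1) ↔
        (y.1 = x.2 ∧ z = (y.2, x.1))) :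
    ((N : ℝ) ^ 2 * Real.exp (-4 * Real.sqrt (Real.log N))) ≤
      3 * (Fintype.card S : ℝ) ^ r := by
  classical
  let M₀ : Subgroup (MulAut S) := (MulAut.conj : S →* MulAut S).range
  have hc' : ∀ g h : S, c g = c h ↔ ∃ φ : M₀, (φ : MulAut S) g = h := by
    intro g h
    rw [hc g h, isConj_iff]
    constructor
    · rintro ⟨x, hx⟩
      exact ⟨⟨MulAut.conj x, x, rfl⟩, by simpa using hx⟩
    · rintro ⟨⟨φ, x, rfl⟩, hx⟩
      exact ⟨x, by simpa using hx⟩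
  exact translationScheme_card_ge_behrend_group S r hbound M₀ C c hc' N A B Γ hreal

/-- **Group association schemes of exponent-`3` class-`2` groups** (and every fusion `𝒮(S, M₀)`,
`M₀ ≤ Aut S`): a realization of `⟨3N,3N,3N⟩` forces `N² e^{-4√(log N)} ≤ 3 |S|^{24/25}`, i.e.
`|S| ≥ n^{25/12 - o(1)}`. [this work] -/
theorem groupScheme_exp_three_class_two (S : Type) [Group S] [Fintype S] [DecidableEq S]
    [Group.IsNilpotent S] (hcl : Group.nilpotencyClass S ≤ 2) (hexpS : ∀ g : S, g ^ 3 = 1)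
    (C : Type) (c : S → C) (hc : ∀ g h : S, c g = c h ↔ IsConj g h) (N : ℕ)
    (A B Γ : Fin (3 * N) × Fin (3 * N) → C)
    (hreal : ∀ x y z : Fin (3 * N) × Fin (3 * N),
      (∃ g h l : S, c g = A x ∧ c h = B y ∧ c l = Γ z ∧ g * h * l = 1) ↔
        (y.1 = x.2 ∧ z = (y.2, x.1))) :
    ((N : ℝ) ^ 2 * Real.exp (-4 * Real.sqrt (Real.log N))) ≤
      3 * (Fintype.card S : ℝ) ^ (24 / 25 : ℝ) :=
  groupScheme_card_ge_behrend S (24 / 25)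
    (fun σ _ φ ψ ι _ x y z hmatch =>
      twistedMatching_card_le_exp_three_class_two S hcl hexpS σ φ ψ ι x y z hmatch)
    C c hc N A B Γ hreal

/-- **Ineffective headline for `p`-groups of bounded class and exponent**: with the `δ(p,c,e) > 0` of
`exists_pGroupTwistedMatching_card_le`, every realization of `⟨3N,3N,3N⟩` in a translation scheme
`𝒮(S, M₀)` over a finite `p`-group `S` of class `≤ c` and exponent dividing `p^e` — in particular in
its group association scheme — forces `N² e^{-4√(log N)} ≤ 3 |S|^{1-δ}`. [this work] -/
theorem translationScheme_pGroup_card_ge_behrend (p : ℕ) [Fact p.Prime] (c e : ℕ) (he : 0 < e) :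
    ∃ δ : ℝ, 0 < δ ∧ ∀ (S : Type) [Group S] [Fintype S] [DecidableEq S] [Group.IsNilpotent S],
      Group.nilpotencyClass S ≤ c → Monoid.exponent S ∣ p ^ e →
      ∀ (M₀ : Subgroup (MulAut S)) [Fintype M₀] (C : Type) (c : S → C),
      (∀ g h : S, c g = c h ↔ ∃ φ : M₀, (φ : MulAut S) g = h) →
      ∀ (N : ℕ) (A B Γ : Fin (3 * N) × Fin (3 * N) → C),
      (∀ x y z : Fin (3 * N) × Fin (3 * N),
          (∃ g h l : S, c g = A x ∧ c h = B y ∧ c l = Γ z ∧ g * h * l = 1) ↔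
          (y.1 = x.2 ∧ z = (y.2, x.1))) →
      ((N : ℝ) ^ 2 * Real.exp (-4 * Real.sqrt (Real.log N))) ≤
        3 * (Fintype.card S : ℝ) ^ (1 - δ) := by
  obtain ⟨δ, hδ, hb⟩ := exists_pGroupTwistedMatching_card_le p c e he
  refine ⟨δ, hδ, ?_⟩
  intro S _ _ _ _ hcl hexp M₀ _ C c hc N A B Γ hreal
  exact translationScheme_card_ge_behrend_group S (1 - δ)
    (fun σ _ φ ψ ι _ x y z hmatch => hb S hcl hexp σ φ ψ ι x y z hmatch) M₀ C c hc N A B Γ hreal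

end GroupSchemes

end Summit.MatrixMultiplication.MatrixMultiplication.Theorems.TwistedSliceRank
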